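import Summits.MatrixMultiplication.MatrixMultiplication.Theorems.AbelianSTPPCensusFP4CheckTarget

/-!
# Rule U11-F4, checker soundness II: boxes, sum tightening, one letter form (`narrowForm`)

Cell mm-stpp (rung F-M1), theory lane (seat mm-stpp-theory, gen 17).  Second of three files proving `FP4.check` sound.  Semantics: `VIn lo hi v`
(a vector inside a box, entrywise), label tables by `decide` (`subQ`, `negQ` stay in `0..3`, `negQ` is an involution, `g ↦ c − g`
permutes the labels so `Σ_g v_{c−g} = Σ v`), views through negation (`VIn.neg`, `VIn.unneg`), sum tightening keeps vectors of the right
total (`VIn.tight`, `okVec_of_VIn`).  For one letter form: `TargetOK` at the true point yields the semantic package `TgtIn` of the four pair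
boxes built by `mkPr` (`tgtIn_of_targetOK`), the scan starts above the true target count by (F2) mass, (F3) pointwise and (F4)
(`le_startH`), hence `newH ≥ W` (`le_newH`) and `narrowForm` returns new upper bounds still containing the true target vector
(`narrowForm_some`).  WHAT THIS IS NOT: no census number, no `ω` statement.
-/

set_option linter.dupNamespace false -- `MatrixMultiplication.MatrixMultiplication` (summit = problem, D-0017)
set_option autoImplicit false

namespace Summit.MatrixMultiplication.MatrixMultiplication.Theorems

open Finset

namespace FP4

/-! ### Checker soundness, part 2: boxes, propagation, bisection -/

section CheckBox

/-! #### Label tables (finite facts, by `decide`) -/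

/-- `subQ` lands in `0..3`. [bookkeeping] -/
theorem subQ_lt {e c g : ℕ} (he : e ≤ 1) (hc : c < 4) (hg : g < 4) : subQ e c g < 4 := by
  have h : ∀ e < 2, ∀ c < 4, ∀ g < 4, subQ e c g < 4 := by decide
  exact h e (by omega) c hc g hg

/-- `negQ` lands in `0..3`. [bookkeeping] -/
theorem negQ_lt {e g : ℕ} (he : e ≤ 1) (hg : g < 4) : negQ e g < 4 := by
  have h : ∀ e < 2, ∀ g < 4, negQ e g < 4 := by decide
  exact h e (by omega) g hg

/-- `negQ` is an involution. [bookkeeping] -/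
theorem negQ_negQ {e g : ℕ} (he : e ≤ 1) (hg : g < 4) : negQ e (negQ e g) = g := by
  have h : ∀ e < 2, ∀ g < 4, negQ e (negQ e g) = g := by decide
  exact h e (by omega) g hg

/-! #### `Q4` access -/

/-- `Q4.get` at the four labels. [bookkeeping] -/
theorem Q4.get_mk (a b c d : ℕ) :
    (⟨a, b, c, d⟩ : Q4).get 0 = a ∧ (⟨a, b, c, d⟩ : Q4).get 1 = b ∧ (⟨a, b, c, d⟩ : Q4).get 2 = c ∧ (⟨a, b, c, d⟩ : Q4).get 3 = d :=
  ⟨rfl, rfl, rfl, rfl⟩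

/-- `v ∈ [lo, hi]` entrywise (semantics of a box of one vector). [original] -/
def VIn (lo hi v : Q4) : Prop :=
  lo.v0 ≤ v.v0 ∧ v.v0 ≤ hi.v0 ∧ lo.v1 ≤ v.v1 ∧ v.v1 ≤ hi.v1 ∧ lo.v2 ≤ v.v2 ∧ v.v2 ≤ hi.v2 ∧ lo.v3 ≤ v.v3 ∧ v.v3 ≤ hi.v3

/-- Entrywise reading of `VIn` through `get`. [bookkeeping] -/
theorem VIn.get {lo hi v : Q4} (h : VIn lo hi v) (g : ℕ) : lo.get g ≤ v.get g ∧ v.get g ≤ hi.get g := by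
  obtain ⟨h0, h1, h2, h3, h4, h5, h6, h7⟩ := h
  match g with
  | 0 => exact ⟨h0, h1⟩
  | 1 => exact ⟨h2, h3⟩
  | 2 => exact ⟨h4, h5⟩
  | n + 3 => exact ⟨h6, h7⟩

/-- `VIn` from entrywise bounds at the four labels. [bookkeeping] -/
theorem VIn.of_get {lo hi v : Q4} (h : ∀ g, g < 4 → lo.get g ≤ v.get g ∧ v.get g ≤ hi.get g) : VIn lo hi v := by
  have h0 := h 0 (by omega); have h1 := h 1 (by omega); have h2 := h 2 (by omega); have h3 := h 3 (by omega)
  cases lo; cases hi; cases v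
  exact ⟨h0.1, h0.2, h1.1, h1.2, h2.1, h2.2, h3.1, h3.2⟩

/-- `(q.neg e).get g = q.get (negQ e g)` for labels `g < 4`. [bookkeeping] -/
theorem Q4.get_neg (e : ℕ) (q : Q4) {g : ℕ} (hg : g < 4) : (q.neg e).get g = q.get (negQ e g) := by
  unfold Q4.neg
  match g, hg with
  | 0, _ => rfl
  | 1, _ => rfl
  | 2, _ => rfl
  | 3, _ => rfl

/-- Negated views stay inside negated boxes. [bookkeeping] -/
theorem VIn.neg {lo hi v : Q4} (h : VIn lo hi v) (e : ℕ) : VIn (lo.neg e) (hi.neg e) (v.neg e) := by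
  refine VIn.of_get fun g hg => ?_
  rw [Q4.get_neg e lo hg, Q4.get_neg e hi hg, Q4.get_neg e v hg]
  exact h.get _

/-- The sum read through `get`. [bookkeeping] -/
theorem Q4.sum_eq_get (q : Q4) : q.sum = q.get 0 + q.get 1 + q.get 2 + q.get 3 := rfl

/-- `g ↦ c − g` permutes the four labels: `Σ_g v_{c−g} = Σ v`. [bookkeeping] -/
theorem Q4.sum_sub {e c : ℕ} (he : e ≤ 1) (hc : c < 4) (v : Q4) :
    v.get (subQ e c 0) + v.get (subQ e c 1) + v.get (subQ e c 2) + v.get (subQ e c 3) = v.sum := by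
  rw [Q4.sum_eq_get]
  rcases Nat.le_one_iff_eq_zero_or_eq_one.mp he with rfl | rfl <;>
  · interval_cases c <;> norm_num only [subQ, addQ, negQ] <;> omega

/-- An entry is at most the sum. [bookkeeping] -/
theorem Q4.get_le_sum (q : Q4) (g : ℕ) : q.get g ≤ q.sum := by
  rw [Q4.sum_eq_get]
  match g with
  | 0 => omega
  | 1 => omega
  | 2 => omega
  | n + 3 => show q.v3 ≤ _; change q.v3 ≤ q.get 0 + q.get 1 + q.get 2 + q.v3; omega

/-! #### Sum tightening -/

/-- Sum tightening keeps every vector of the right total. [original] -/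
theorem VIn.tight {lo hi v : Q4} (h : VIn lo hi v) {T : ℕ} (hT : v.sum = T) : VIn (tightLo T lo hi) (tightHi T lo hi) v := by
  obtain ⟨h0, h1, h2, h3, h4, h5, h6, h7⟩ := h
  unfold Q4.sum at hT
  unfold tightLo tightHi
  refine ⟨?_, ?_, ?_, ?_, ?_, ?_, ?_, ?_⟩ <;> dsimp only <;> omega

/-- A box containing a vector of total `T` passes `okVec`. [bookkeeping] -/
theorem okVec_of_VIn {lo hi v : Q4} (h : VIn lo hi v) {T : ℕ} (hT : v.sum = T) : okVec T lo hi = true := by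
  obtain ⟨h0, h1, h2, h3, h4, h5, h6, h7⟩ := h
  unfold Q4.sum at hT
  unfold okVec Q4.ble Q4.sum
  simp only [Bool.and_eq_true, decide_eq_true_eq]
  omega

/-! #### One form: the target semantics and `narrowForm` -/

/-- The pair boxes built by `mkPr` contain the true pairs. [bookkeeping] -/
theorem prIn_mkPr {e c g : ℕ} {ul uh vl vh u v : Q4} (hu : VIn ul uh u) (hv : VIn vl vh v) :
    PrIn (mkPr e c g ul uh vl vh) (u.get g) (v.get (subQ e c g)) := by
  unfold mkPr PrIn
  exact ⟨(hu.get g).1, (hu.get g).2, (hv.get _).1, (hv.get _).2⟩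

/-- From `TargetOK` at the true point to the semantic package `TgtIn` of the four pair boxes. [original] -/
theorem tgtIn_of_targetOK {p e cap vmin SU SV c : ℕ} {u v ul uh vl vh : Q4} {W : ℕ} (he : e ≤ 1) (hc : c < 4)
    (hT : TargetOK p e cap vmin u v c W) (hsu : u.sum = SU) (hsv : v.sum = SV) (hu : VIn ul uh u) (hv : VIn vl vh v) :
    TgtIn p cap (SU + SV) W (mkPr e c 0 ul uh vl vh) (mkPr e c 1 ul uh vl vh) (mkPr e c 2 ul uh vl vh) (mkPr e c 3 ul uh vl vh)
      (u.get 0) (v.get (subQ e c 0)) (u.get 1) (v.get (subQ e c 1)) (u.get 2) (v.get (subQ e c 2)) (u.get 3) (v.get (subQ e c 3)) where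
  in0 := prIn_mkPr hu hv
  in1 := prIn_mkPr hu hv
  in2 := prIn_mkPr hu hv
  in3 := prIn_mkPr hu hv
  hW := hT.1
  hS := by
    have h1 := Q4.sum_sub he hc v
    rw [← hsu, ← hsv, Q4.sum_eq_get u]
    omega
  hF := fun τ0 τ1 τ2 τ3 a0 b0 a1 b1 a2 b2 a3 b3 => hT.2.1 τ0 τ1 τ2 τ3 a0 b0 a1 b1 a2 b2 a3 b3

/-- The scan's starting bound is above the true target count ((F2) mass, (F3) pointwise, (F4), and the old bound). [original] -/
theorem le_startH {p e cap vmin c wh : ℕ} {u v ul uh vl vh : Q4} {W : ℕ}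
    (hT : TargetOK p e cap vmin u v c W) (hu : VIn ul uh u) (hv : VIn vl vh v) (hW : W ≤ wh) :
    W ≤ startH p vmin wh (mkPr e c 0 ul uh vl vh) (mkPr e c 1 ul uh vl vh) (mkPr e c 2 ul uh vl vh) (mkPr e c 3 ul uh vl vh) := by
  obtain ⟨hWp, -, hmass, hpt⟩ := hT
  have b0 := (hu.get 0).2; have b1 := (hu.get 1).2; have b2 := (hu.get 2).2; have b3 := (hu.get 3).2
  have d0 := (hv.get (subQ e c 0)).2; have d1 := (hv.get (subQ e c 1)).2
  have d2 := (hv.get (subQ e c 2)).2; have d3 := (hv.get (subQ e c 3)).2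
  unfold startH ptHi massHi mkPr
  dsimp only
  have hpt' : ptHi (mkPr e c 0 ul uh vl vh) (mkPr e c 1 ul uh vl vh) (mkPr e c 2 ul uh vl vh) (mkPr e c 3 ul uh vl vh) < vmin → W = 0 := by
    intro hlt
    by_contra hne
    have h1 := hpt (Nat.one_le_iff_ne_zero.mpr hne)
    unfold ptHi mkPr at hlt
    dsimp only at hlt
    have m0 : min (u.get 0) (v.get (subQ e c 0)) ≤ min (uh.get 0) (vh.get (subQ e c 0)) := min_le_min b0 d0
    have m1 : min (u.get 1) (v.get (subQ e c 1)) ≤ min (uh.get 1) (vh.get (subQ e c 1)) := min_le_min b1 d1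
    have m2 : min (u.get 2) (v.get (subQ e c 2)) ≤ min (uh.get 2) (vh.get (subQ e c 2)) := min_le_min b2 d2
    have m3 : min (u.get 3) (v.get (subQ e c 3)) ≤ min (uh.get 3) (vh.get (subQ e c 3)) := min_le_min b3 d3
    omega
  split_ifs with hlt hv0
  · exact (hpt' hlt).le
  · refine le_min (le_min hW hWp) hWp
  · refine le_min (le_min hW hWp) ?_
    rw [Nat.le_div_iff_mul_le (Nat.pos_of_ne_zero hv0)]
    have e0 := Nat.mul_le_mul b0 d0; have e1 := Nat.mul_le_mul b1 d1
    have e2 := Nat.mul_le_mul b2 d2; have e3 := Nat.mul_le_mul b3 d3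
    rw [Nat.mul_comm]
    omega

/-- `newH` is above the true target count. [original] -/
theorem le_newH {p e cap vmin SU SV c wh : ℕ} (menu : List ℕ) {u v ul uh vl vh : Q4} {W : ℕ} (he : e ≤ 1) (hc : c < 4)
    (hT : TargetOK p e cap vmin u v c W) (hsu : u.sum = SU) (hsv : v.sum = SV) (hu : VIn ul uh u) (hv : VIn vl vh v)
    (hW : W ≤ wh) : W ≤ newH p e cap vmin (SU + SV) menu c wh ul uh vl vh := by
  unfold newH
  rw [seqPr_eq, seqPr_eq, seqPr_eq, seqPr_eq]
  exact le_scanW menu (tgtIn_of_targetOK he hc hT hsu hsv hu hv) _ (le_startH hT hu hv hW)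

/-- **One form on a box**: if the box contains the true class counts of a form, `narrowForm` returns new upper bounds for the target vector
that still contain it. [original] -/
theorem narrowForm_some {p e cap vmin SU SV SW : ℕ} (menu : List ℕ) {u v w ul uh vl vh wl wh : Q4} (he : e ≤ 1)
    (hF : FormOK p e cap vmin SU SV SW u v w) (hu : VIn ul uh u) (hv : VIn vl vh v) (hw : VIn wl wh w) :
    ∃ wh' : Q4, narrowForm p e cap vmin (SU + SV) menu ul uh vl vh wl wh = some wh' ∧ VIn wl wh' w := by
  obtain ⟨hsu, hsv, -, -, -, -, -, -, -, -, -, t0, t1, t2, t3⟩ := hF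
  have g0 := le_newH menu he (by omega) t0 hsu hsv hu hv (hw.get 0).2
  have g1 := le_newH menu he (by omega) t1 hsu hsv hu hv (hw.get 1).2
  have g2 := le_newH menu he (by omega) t2 hsu hsv hu hv (hw.get 2).2
  have g3 := le_newH menu he (by omega) t3 hsu hsv hu hv (hw.get 3).2
  have l0 := (hw.get 0).1; have l1 := (hw.get 1).1; have l2 := (hw.get 2).1; have l3 := (hw.get 3).1
  unfold narrowForm
  rw [seqN_eq, seqN_eq, seqN_eq, seqN_eq]
  refine ⟨⟨newH p e cap vmin (SU + SV) menu 0 (wh.get 0) ul uh vl vh, newH p e cap vmin (SU + SV) menu 1 (wh.get 1) ul uh vl vh,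
    newH p e cap vmin (SU + SV) menu 2 (wh.get 2) ul uh vl vh, newH p e cap vmin (SU + SV) menu 3 (wh.get 3) ul uh vl vh⟩, ?_, ?_⟩
  · rw [if_neg (by omega)]
  · refine VIn.of_get fun g hg => ⟨(hw.get g).1, ?_⟩
    match g, hg with
    | 0, _ => exact g0
    | 1, _ => exact g1
    | 2, _ => exact g2
    | 3, _ => exact g3

end CheckBox

end FP4

end Summit.MatrixMultiplication.MatrixMultiplication.Theorems
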